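import Literature.Geometry.Lorentzian.CoordRicciCovariance
import Literature.Geometry.Lorentzian.KerrSchildCoord
import Summits.FinalStateConjecture.FinalStateConjecture.Theorems.BartnikGapSettlingGapExhaustionIKStepFrame
import Summits.FinalStateConjecture.FinalStateConjecture.Theorems.BartnikGapSettlingGapExhaustionAffineCovariance
import Summits.FinalStateConjecture.FinalStateConjecture.Theorems.BartnikGapSettlingGapExhaustionAffineIteratedFDerivBounds
import HarnessLib

/-!
# Crux `GapExhaustion` (stmt-FinalStateConjecture-10808), line `photon-shell-pseudoconvexity`:
# stub (N-6c) `stub_ikQuant6` — the NORMALISED DATA at a cylinder point and Ionescu–Klainerman's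
# hypotheses one by one (metric datum, Ricci, `G p = η`, smoothness constant, non-degeneracy,
# quantitative pseudo-convexity)

Route `BartnikGapSettling`; helper (`--supports stmt-FinalStateConjecture-10808`) of line lead
c10, second file of the reduction of the outward sweep S5 to IK's local extension theorem. Data:
a metric datum `G` on an open `W ⊆ E4` with `ricAt G = 0`, a point `x ∈ W` on the cylinder
`{r = c}`, an exact frame `L` at `x` (`G x (L·, L·) = η`, file N-6a), a scale `0 < s ≤ 1`,
`Ls = s L`, and the normalised data through defining equations (opaque names):
`Gt y = s⁻² G(x + Ls y) ∘ (Ls × Ls)`, `ft y = s⁻² (r(x + Ls y) − c)`. We prove: `Gt` is the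
constant rescaling of the pull-back of `G` by the affine change `y ↦ x + Ls y`, hence a metric
datum with vanishing Ricci form (`ricAt_pullMetric_eq_zero`, `ricAt_const_smul_eq`) and `Gt 0 = η`
(`ikStep_Gt_basic`); `ft 0 = 0`, `D ft(0) = s⁻¹ Dr(x) ∘ L` (`ikStep_ft_basic`); IK's smoothness
sum `Σ_{j=1}^6 ‖Dʲ Gt‖ + Σ_{j=1}^4 ‖Dʲ ft‖ ≤ 6·6⁸(C_K + 1) + 4·6⁴ C_K / s` from band bounds
(`ikStep_bound_A`, via `stub_affineIteratedFDerivBounds` p133370); and the registered stub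
`stub_ikQuant6`: `‖D ft(0)‖ ≥ A₁⁻¹` and (quant6) at the origin with constant `A₁`, from the
multiplier form of IK JAMS 2013 Lemma 2.11 (a) at `x` transported by `affineCov_hessAt` /
`affineCov_constSmul` (p133643).
-/

noncomputable section

set_option maxSynthPendingDepth 3

-- D-0017: single-problem summit, `Summit.<S>.<S>.…` by design (cf. lakefile `weak.linter.dupNamespace`).
set_option linter.dupNamespace false

namespace Summit.FinalStateConjecture.FinalStateConjecture.Theorems

open Set Function Metric
open Literature.Geometry.Lorentzian Literature.Geometry.Lorentzian.MetricCoord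
open scoped Manifold ContDiff Topology ENNReal

/-! ### Calculus helpers -/

/-- `Dʲ(α (g − β)) = α Dʲ g` at a point of smoothness, `j ≥ 1`. [folklore] -/
theorem ikStep_iteratedFDeriv_const_mul_sub {g : E4 → ℝ} {O : Set E4} (hO : IsOpen O)
    (hg : ContDiffOn ℝ ∞ g O) (α β : ℝ) {j : ℕ} (hj : 1 ≤ j) {z : E4} (hz : z ∈ O) :
    iteratedFDeriv ℝ j (fun y => α * (g y - β)) z = α • iteratedFDeriv ℝ j g z := by
  have hgz : ContDiffAt ℝ j g z :=
    ((hg z hz).contDiffAt (hO.mem_nhds hz)).of_le (by exact_mod_cast le_top)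
  have hcz : ContDiffAt ℝ j (fun _ : E4 => β) z := contDiffAt_const
  have hsub : ContDiffAt ℝ j (g - fun _ : E4 => β) z := hgz.sub hcz
  have h1 : (fun y => α * (g y - β)) = α • (g - fun _ : E4 => β) := by
    funext y; simp [smul_eq_mul]
  rw [h1, iteratedFDeriv_const_smul_apply hsub, iteratedFDeriv_sub_apply hgz hcz,
    iteratedFDeriv_const_of_ne (by omega) β]
  simp

/-- `Dʲ(α • P) = α • Dʲ P` at a point of smoothness. [folklore] -/
theorem ikStep_iteratedFDeriv_const_smul {F : Type*} [NormedAddCommGroup F] [NormedSpace ℝ F]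
    {P : E4 → F} {O : Set E4} (hO : IsOpen O) (hP : ContDiffOn ℝ ∞ P O) (α : ℝ) (j : ℕ)
    {z : E4} (hz : z ∈ O) :
    iteratedFDeriv ℝ j (fun y => α • P y) z = α • iteratedFDeriv ℝ j P z := by
  have hPz : ContDiffAt ℝ j P z :=
    ((hP z hz).contDiffAt (hO.mem_nhds hz)).of_le (by exact_mod_cast le_top)
  exact iteratedFDeriv_const_smul_apply' hPz

/-- Restriction of a metric datum to an open subset. [folklore] -/
theorem ikStep_isMetricOn_mono {G : E4 → E4 →L[ℝ] E4 →L[ℝ] ℝ} {V V' : Set E4}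
    (hG : IsMetricOn G V) (hV' : IsOpen V') (hV'V : V' ⊆ V) : IsMetricOn G V' where
  isOpen := hV'
  contDiffOn := hG.contDiffOn.mono hV'V
  symm x hx := hG.symm x (hV'V hx)
  isInvertible x hx := hG.isInvertible x (hV'V hx)

/-- `Hess (α (u − β)) = α Hess u` for `u` of class `C²` at the point. [folklore] -/
theorem ikStep_hessAt_const_mul_sub (G : E4 → E4 →L[ℝ] E4 →L[ℝ] ℝ) {u : E4 → ℝ} {x : E4}
    (hu : ContDiffAt ℝ 2 u x) (α β : ℝ) :
    hessAt G (fun y => α * (u y - β)) x = α • hessAt G u x := by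
  have hev : ∀ᶠ y in 𝓝 x, ContDiffAt ℝ 2 u y := hu.eventually (by simp)
  have h1 : fderiv ℝ (fun y => α * (u y - β)) =ᶠ[𝓝 x] fun y => α • fderiv ℝ u y := by
    filter_upwards [hev] with y hy
    have hd : DifferentiableAt ℝ u y := hy.differentiableAt (by simp)
    rw [fderiv_const_mul (hd.sub_const β), fderiv_sub_const]
  have hdu : DifferentiableAt ℝ (fderiv ℝ u) x :=
    (hu.fderiv_right (m := 1) (by norm_num)).differentiableAt one_ne_zero
  have h2 : fderiv ℝ (fderiv ℝ (fun y => α * (u y - β))) x = α • fderiv ℝ (fderiv ℝ u) x := by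
    rw [h1.fderiv_eq]; exact fderiv_fun_const_smul hdu α
  have h3 : fderiv ℝ (fun y => α * (u y - β)) x = α • fderiv ℝ u x := h1.eq_of_nhds
  ext Y Z
  simp only [hessAt_apply, h2, h3, smul_apply, smul_eq_mul]
  ring

/-! ### The normalised data at a cylinder point -/

section NormalisedData

variable {G : E4 → E4 →L[ℝ] E4 →L[ℝ] ℝ} {W : Set E4} {a c s : ℝ} {x : E4} {L Ls : E4 ≃L[ℝ] E4}
  {Gt : E4 → E4 →L[ℝ] E4 →L[ℝ] ℝ} {ft : E4 → ℝ}

/-- `Gt` is a metric datum on the preimage of `W`, it is `η` at the origin, its Ricci form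
vanishes where that of `G` does, and `Gt y v w = s⁻² G(x + Ls y)(Ls v, Ls w)`. [folklore] -/
theorem ikStep_Gt_basic (hGmet : IsMetricOn G W) (hric : ∀ z ∈ W, ricAt G z = 0)
    (hs : 0 < s) (hLs : ∀ v : E4, Ls v = s • L v)
    (hL : ∀ v w : E4, G x (L v) (L w) = Minkowski.bilin v w)
    (hGt : ∀ y : E4, Gt y =
      (s ^ 2)⁻¹ • (G (x + Ls y)).bilinearComp (Ls : E4 →L[ℝ] E4) (Ls : E4 →L[ℝ] E4)) :
    IsMetricOn Gt ((fun y : E4 => x + Ls y) ⁻¹' W) ∧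
    (∀ y ∈ (fun y : E4 => x + Ls y) ⁻¹' W, ricAt Gt y = 0) ∧
    Gt 0 = Minkowski.bilin ∧
    (∀ y ∈ (fun y : E4 => x + Ls y) ⁻¹' W, ∀ f : E4 → ℝ,
      hessAt Gt f y = hessAt (pullMetric G (fun y : E4 => x + Ls y)) f y) ∧
    (∀ y v w : E4, Gt y v w = (s ^ 2)⁻¹ * G (x + Ls y) (Ls v) (Ls w)) := by
  have hs2 : (s ^ 2)⁻¹ ≠ 0 := by positivity
  set P : E4 → E4 →L[ℝ] E4 →L[ℝ] ℝ :=
    fun y => (G (x + Ls y)).bilinearComp (Ls : E4 →L[ℝ] E4) (Ls : E4 →L[ℝ] E4) with hPdef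
  have hGt' : Gt = fun y => (s ^ 2)⁻¹ • P y := funext hGt
  have hcc : IsCoordChangeOn (fun y : E4 => x + Ls y) ((fun y : E4 => x + Ls y) ⁻¹' W) W :=
    affineCov_isCoordChangeOn hGmet Ls x
  have hPeq : P = pullMetric G (fun y : E4 => x + Ls y) := affineCov_eq_pullMetric G Ls x
  have hPmet : IsMetricOn P ((fun y : E4 => x + Ls y) ⁻¹' W) := by
    rw [hPeq]; exact hGmet.isMetricOn_pullMetric hcc
  obtain ⟨hGtmet, hGtchr⟩ := affineCov_constSmul P _ ((s ^ 2)⁻¹) hs2 hPmet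
  refine ⟨hGt' ▸ hGtmet, fun y hy ↦ ?_, ?_, fun y hy f ↦ ?_, fun y v w ↦ ?_⟩
  · rw [hGt', hPmet.ricAt_const_smul_eq hy hs2, hPeq]
    exact hGmet.ricAt_pullMetric_eq_zero hcc hy (hric _ hy)
  · ext v w
    rw [hGt, smul_apply, smul_apply, ContinuousLinearMap.bilinearComp_apply, smul_eq_mul]
    simp only [ContinuousLinearEquiv.coe_coe, map_zero, smul_zero, add_zero, hLs, map_smul,
      smul_apply, smul_eq_mul, hL]
    field_simp
  · rw [hGt', ((hGtchr y hy).2 f), hPeq]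
  · rw [hGt, smul_apply, smul_apply, ContinuousLinearMap.bilinearComp_apply, smul_eq_mul]
    simp only [ContinuousLinearEquiv.coe_coe]

/-- `ft` is smooth near points where `r` is, vanishes at the origin when `r x = c`, and
`D ft(0) X = s⁻¹ Dr(x)(L X)`. [folklore] -/
theorem ikStep_ft_basic (hs : 0 < s) (hLs : ∀ v : E4, Ls v = s • L v) (hx : Kerr.radius a x = c)
    (hft : ∀ y : E4, ft y = (s ^ 2)⁻¹ * (Kerr.radius a (x + Ls y) - c))
    (hr0 : ContDiffAt ℝ ∞ (Kerr.radius a) x) :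
    ft 0 = 0 ∧
    (∀ X : E4, fderiv ℝ ft 0 X = s⁻¹ * fderiv ℝ (Kerr.radius a) x (L X)) ∧
    fderiv ℝ ft 0 = s⁻¹ • (fderiv ℝ (Kerr.radius a) x).comp (L : E4 →L[ℝ] E4) ∧
    (∀ y : E4, ContDiffAt ℝ ∞ (Kerr.radius a) (x + Ls y) → ContDiffAt ℝ ∞ ft y) := by
  have hft' : ft = fun y => (s ^ 2)⁻¹ * (Kerr.radius a (x + Ls y) - c) := funext hft
  have haff0 : x + Ls 0 = x := by simp
  have hs0 : s ≠ 0 := hs.ne'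
  -- the derivative at `0`
  have hrd : HasFDerivAt (Kerr.radius a) (fderiv ℝ (Kerr.radius a) (x + Ls 0)) (x + Ls 0) := by
    rw [haff0]; exact (hr0.differentiableAt (by simp)).hasFDerivAt
  have h1 : HasFDerivAt ((Kerr.radius a) ∘ (fun y : E4 => x + Ls y))
      ((fderiv ℝ (Kerr.radius a) (x + Ls 0)).comp (Ls : E4 →L[ℝ] E4)) 0 :=
    HasFDerivAt.comp (g := Kerr.radius a) (f := fun y : E4 => x + Ls y) (0 : E4) hrd
      (affineCov_hasFDerivAt Ls x 0)
  have h1' : HasFDerivAt (fun y : E4 => Kerr.radius a (x + Ls y))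
      ((fderiv ℝ (Kerr.radius a) (x + Ls 0)).comp (Ls : E4 →L[ℝ] E4)) 0 := by
    simpa only [Function.comp_def] using h1
  have h2 : HasFDerivAt (fun y : E4 => (s ^ 2)⁻¹ * (Kerr.radius a (x + Ls y) - c))
      ((s ^ 2)⁻¹ • ((fderiv ℝ (Kerr.radius a) (x + Ls 0)).comp (Ls : E4 →L[ℝ] E4))) 0 :=
    (h1'.sub_const c).const_mul ((s ^ 2)⁻¹)
  have hfd : ∀ X : E4, fderiv ℝ ft 0 X = s⁻¹ * fderiv ℝ (Kerr.radius a) x (L X) := by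
    intro X
    rw [hft', h2.fderiv, haff0, smul_apply, ContinuousLinearMap.comp_apply, smul_eq_mul,
      ContinuousLinearEquiv.coe_coe, hLs, map_smul, smul_eq_mul]
    field_simp
  refine ⟨by simp [hft, hx], hfd, ?_, fun y hry ↦ ?_⟩
  · ext X
    rw [hfd, smul_apply, ContinuousLinearMap.comp_apply, smul_eq_mul, ContinuousLinearEquiv.coe_coe]
  · have haff : ContDiff ℝ ∞ (fun y : E4 => x + Ls y) :=
      contDiff_const.add (Ls : E4 →L[ℝ] E4).contDiff
    have g1 : ContDiffAt ℝ ∞ ((Kerr.radius a) ∘ (fun y : E4 => x + Ls y)) y :=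
      ContDiffAt.comp (g := Kerr.radius a) (f := fun y : E4 => x + Ls y) y hry haff.contDiffAt
    have g1' : ContDiffAt ℝ ∞ (fun y : E4 => Kerr.radius a (x + Ls y)) y := by
      simpa only [Function.comp_def] using g1
    rw [hft']
    exact contDiffAt_const.mul (g1'.sub contDiffAt_const)

/-- The operator norm of the scaled frame: `‖Ls‖ ≤ 6 s`. [folklore] -/
theorem ikStep_norm_Ls (hs : 0 < s) (hLs : (Ls : E4 →L[ℝ] E4) = s • (L : E4 →L[ℝ] E4))
    (hL6 : ‖(L : E4 →L[ℝ] E4)‖ ≤ 6) : ‖(Ls : E4 →L[ℝ] E4)‖ ≤ 6 * s := by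
  rw [hLs, norm_smul, Real.norm_eq_abs, abs_of_pos hs]
  calc s * ‖(L : E4 →L[ℝ] E4)‖ ≤ s * 6 := mul_le_mul_of_nonneg_left hL6 hs.le
    _ = 6 * s := by ring

/-- **IK's smoothness constant.** At a point `y` whose image `x + Ls y` lies in `W` with
`r > 0`, the derivative sums of the normalised data are bounded by
`6·6⁸(C_K + 1) + 4·6⁴ C_K / s`, from the band bounds `‖Dʲ r‖ ≤ C_K`, `‖Dʲ G‖ ≤ C_K + 1`
(`j ≤ 6`). [folklore] -/
theorem ikStep_bound_A (hGmet : IsMetricOn G W) (hs : 0 < s) (hs1 : s ≤ 1)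
    (hLs : (Ls : E4 →L[ℝ] E4) = s • (L : E4 →L[ℝ] E4)) (hL6 : ‖(L : E4 →L[ℝ] E4)‖ ≤ 6)
    (hGt : ∀ y : E4, Gt y =
      (s ^ 2)⁻¹ • (G (x + Ls y)).bilinearComp (Ls : E4 →L[ℝ] E4) (Ls : E4 →L[ℝ] E4))
    (hft : ∀ y : E4, ft y = (s ^ 2)⁻¹ * (Kerr.radius a (x + Ls y) - c))
    {CK : ℝ} (hCK : 0 ≤ CK) {y : E4} (hyW : x + Ls y ∈ W) (hr0 : 0 < Kerr.radius a (x + Ls y))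
    (hKr : ∀ j : ℕ, j ≤ 6 → ‖iteratedFDeriv ℝ j (Kerr.radius a) (x + Ls y)‖ ≤ CK)
    (hKG : ∀ j : ℕ, j ≤ 6 → ‖iteratedFDeriv ℝ j G (x + Ls y)‖ ≤ CK + 1) :
    (∑ j ∈ Finset.Icc 1 6, ‖iteratedFDeriv ℝ j Gt y‖) +
        (∑ j ∈ Finset.Icc 1 4, ‖iteratedFDeriv ℝ j ft y‖) ≤
      6 * (6 ^ 8 * (CK + 1)) + 4 * (6 ^ 4 * CK) / s := by
  have hnLs : ‖(Ls : E4 →L[ℝ] E4)‖ ≤ 6 * s := ikStep_norm_Ls hs hLs hL6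
  have hnLs0 : 0 ≤ ‖(Ls : E4 →L[ℝ] E4)‖ := norm_nonneg _
  have hW : IsOpen W := hGmet.isOpen
  -- the components
  set P : E4 → E4 →L[ℝ] E4 →L[ℝ] ℝ :=
    fun y => (G (x + Ls y)).bilinearComp (Ls : E4 →L[ℝ] E4) (Ls : E4 →L[ℝ] E4) with hPdef
  have hGt' : Gt = fun y => (s ^ 2)⁻¹ • P y := funext hGt
  have hPeq : P = pullMetric G (fun y : E4 => x + Ls y) := affineCov_eq_pullMetric G Ls x
  have hPmet : IsMetricOn P ((fun y : E4 => x + Ls y) ⁻¹' W) := by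
    rw [hPeq]; exact hGmet.isMetricOn_pullMetric (affineCov_isCoordChangeOn hGmet Ls x)
  have hGbound : ∀ j : ℕ, 1 ≤ j → j ≤ 6 → ‖iteratedFDeriv ℝ j Gt y‖ ≤ 6 ^ 8 * (CK + 1) := by
    intro j hj1 hj6
    rw [hGt', ikStep_iteratedFDeriv_const_smul hPmet.isOpen hPmet.contDiffOn _ j hyW, norm_smul,
      Real.norm_eq_abs, abs_of_pos (by positivity)]
    have hP := affineBounds_norm_iteratedFDeriv_bilinearComp_affine_le G (Ls : E4 →L[ℝ] E4)
      (Ls : E4 →L[ℝ] E4) x hW hGmet.contDiffOn j hyW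
    have h1 : ‖(Ls : E4 →L[ℝ] E4)‖ ^ 2 * ‖(Ls : E4 →L[ℝ] E4)‖ ^ j ≤ (6 * s) ^ 2 * (6 * s) ^ j := by
      gcongr
    have h2 : (6 : ℝ) ^ (j + 2) ≤ 6 ^ 8 := pow_le_pow_right₀ (by norm_num) (by omega)
    have h3 : s ^ j ≤ 1 := pow_le_one₀ hs.le hs1
    calc (s ^ 2)⁻¹ * ‖iteratedFDeriv ℝ j P y‖
        ≤ (s ^ 2)⁻¹ * (‖(Ls : E4 →L[ℝ] E4)‖ ^ 2 * ‖(Ls : E4 →L[ℝ] E4)‖ ^ j *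
            ‖iteratedFDeriv ℝ j G (x + Ls y)‖) := by gcongr; exact hP
      _ ≤ (s ^ 2)⁻¹ * ((6 * s) ^ 2 * (6 * s) ^ j * (CK + 1)) := by
          gcongr (s ^ 2)⁻¹ * ?_
          exact mul_le_mul h1 (hKG j hj6) (norm_nonneg _) (by positivity)
      _ = 6 ^ (j + 2) * s ^ j * (CK + 1) := by
          field_simp
          ring
      _ ≤ 6 ^ 8 * 1 * (CK + 1) := by gcongr
      _ = 6 ^ 8 * (CK + 1) := by ring
  -- the defining function
  have hO : IsOpen {z : E4 | 0 < Kerr.radius a z} := isOpen_lt continuous_const (Kerr.continuous_radius a)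
  have hrO : ContDiffOn ℝ ∞ (Kerr.radius a) {z : E4 | 0 < Kerr.radius a z} := fun z hz ↦
    (Kerr.contDiffAt_radius hz).contDiffWithinAt
  have haff : ContDiff ℝ ∞ (fun y : E4 => x + Ls y) := contDiff_const.add (Ls : E4 →L[ℝ] E4).contDiff
  set g : E4 → ℝ := fun y => Kerr.radius a (x + Ls y) with hgdef
  have hO' : IsOpen ((fun y : E4 => x + Ls y) ⁻¹' {z : E4 | 0 < Kerr.radius a z}) :=
    hO.preimage haff.continuous
  have hgO : ContDiffOn ℝ ∞ g ((fun y : E4 => x + Ls y) ⁻¹' {z : E4 | 0 < Kerr.radius a z}) := by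
    have h := hrO.comp (haff.contDiffOn (s := (fun y : E4 => x + Ls y) ⁻¹' {z : E4 | 0 < Kerr.radius a z}))
      (fun z hz ↦ hz)
    simp only [Function.comp_def] at h
    exact h
  have hft' : ft = fun y => (s ^ 2)⁻¹ * (g y - c) := funext hft
  have hfbound : ∀ j : ℕ, 1 ≤ j → j ≤ 4 → ‖iteratedFDeriv ℝ j ft y‖ ≤ 6 ^ 4 * CK / s := by
    intro j hj1 hj4
    rw [hft', ikStep_iteratedFDeriv_const_mul_sub hO' hgO _ c hj1 hr0, norm_smul, Real.norm_eq_abs,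
      abs_of_pos (by positivity)]
    have hsc := affineBounds_norm_iteratedFDeriv_comp_affine_le (Kerr.radius a) (Ls : E4 →L[ℝ] E4) x
      hO hrO j hr0
    have h1 : ‖(Ls : E4 →L[ℝ] E4)‖ ^ j ≤ (6 * s) ^ j := by gcongr
    have h2 : (6 : ℝ) ^ j ≤ 6 ^ 4 := pow_le_pow_right₀ (by norm_num) hj4
    have h3 : s ^ j ≤ s := by
      have := pow_le_pow_of_le_one hs.le hs1 hj1
      rwa [pow_one] at this
    calc (s ^ 2)⁻¹ * ‖iteratedFDeriv ℝ j g y‖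
        ≤ (s ^ 2)⁻¹ * (‖(Ls : E4 →L[ℝ] E4)‖ ^ j * ‖iteratedFDeriv ℝ j (Kerr.radius a) (x + Ls y)‖) := by
          gcongr; exact hsc
      _ ≤ (s ^ 2)⁻¹ * ((6 * s) ^ j * CK) := by
          gcongr (s ^ 2)⁻¹ * ?_
          exact mul_le_mul h1 (hKr j (by omega)) (norm_nonneg _) (by positivity)
      _ = 6 ^ j * CK * (s ^ j / s ^ 2) := by rw [mul_pow]; ring
      _ ≤ 6 ^ 4 * CK * (s / s ^ 2) := by gcongr
      _ = 6 ^ 4 * CK / s := by field_simp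
  -- sum up
  have hsumG : ∑ j ∈ Finset.Icc 1 6, ‖iteratedFDeriv ℝ j Gt y‖ ≤ 6 * (6 ^ 8 * (CK + 1)) := by
    calc ∑ j ∈ Finset.Icc 1 6, ‖iteratedFDeriv ℝ j Gt y‖
        ≤ ∑ j ∈ Finset.Icc 1 6, (6 : ℝ) ^ 8 * (CK + 1) :=
          Finset.sum_le_sum fun j hj ↦ hGbound j (Finset.mem_Icc.1 hj).1 (Finset.mem_Icc.1 hj).2
      _ = 6 * (6 ^ 8 * (CK + 1)) := by
          rw [Finset.sum_const, Nat.card_Icc, nsmul_eq_mul]; norm_num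
  have hsumf : ∑ j ∈ Finset.Icc 1 4, ‖iteratedFDeriv ℝ j ft y‖ ≤ 4 * (6 ^ 4 * CK) / s := by
    calc ∑ j ∈ Finset.Icc 1 4, ‖iteratedFDeriv ℝ j ft y‖
        ≤ ∑ j ∈ Finset.Icc 1 4, (6 : ℝ) ^ 4 * CK / s :=
          Finset.sum_le_sum fun j hj ↦ hfbound j (Finset.mem_Icc.1 hj).1 (Finset.mem_Icc.1 hj).2
      _ = 4 * (6 ^ 4 * CK) / s := by
          rw [Finset.sum_const, Nat.card_Icc, nsmul_eq_mul]; norm_num; ring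
  exact add_le_add hsumG hsumf

end NormalisedData

/-- **IK's quantitative pseudo-convexity (quant6) and non-degeneracy at the centre** (registered
stub N-6c of line lead c10), from the multiplier form of Ionescu–Klainerman JAMS 2013
Lemma 2.11 (a) for `h = r` at `x` (`stub_kerrMultiplierBelowShell`) transported to the
normalised data by the tensoriality of the coordinate Hessian under the affine change and its
invariance under constant rescaling. [cite: IonescuKlainerman2013, Lemma 2.11] -/
theorem stub_ikQuant6 :
    ∀ (G : E4 → E4 →L[ℝ] E4 →L[ℝ] ℝ) (W : Set E4) (a c s : ℝ) (x : E4) (L Ls : E4 ≃L[ℝ] E4)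
      (Gt : E4 → E4 →L[ℝ] E4 →L[ℝ] ℝ) (ft : E4 → ℝ) (ν ε₁ μ₀ A₁ : ℝ),
      IsMetricOn G W → (∀ z ∈ W, ricAt G z = 0) → x ∈ W → 0 < s → s ≤ 1 →
      (∀ v : E4, Ls v = s • L v) → (∀ v w : E4, G x (L v) (L w) = Minkowski.bilin v w) →
      ‖(L.symm : E4 →L[ℝ] E4)‖ ≤ 6 →
      (∀ y : E4, Gt y =
        (s ^ 2)⁻¹ • (G (x + Ls y)).bilinearComp (Ls : E4 →L[ℝ] E4) (Ls : E4 →L[ℝ] E4)) →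
      Kerr.radius a x = c →
      (∀ y : E4, ft y = (s ^ 2)⁻¹ * (Kerr.radius a (x + Ls y) - c)) →
      ContDiffAt ℝ ∞ (Kerr.radius a) x → 0 < ν → 0 < ε₁ → 0 < A₁ →
      ν ≤ ‖fderiv ℝ (Kerr.radius a) x‖ → |μ₀| ≤ ε₁⁻¹ →
      (∀ w : E4, ε₁ ^ 2 * ‖w‖ ^ 2 ≤ μ₀ * G x w w - hessAt G (Kerr.radius a) x w w
        + ε₁⁻¹ ^ 2 * (fderiv ℝ (Kerr.radius a) x w) ^ 2) →
      36 * ε₁⁻¹ ^ 2 ≤ A₁ → ε₁⁻¹ ≤ A₁ → 6 / ν ≤ A₁ →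
      A₁⁻¹ ≤ ‖fderiv ℝ ft 0‖ ∧
      ∃ μ ∈ Icc (-A₁) A₁, ∀ X : E4,
        A₁⁻¹ * ‖X‖ ^ 2 ≤ μ * Gt 0 X X - hessAt Gt ft 0 X X + A₁ * (fderiv ℝ ft 0 X) ^ 2 := by
  intro G W a c s x L Ls Gt ft ν ε₁ μ₀ A₁ hGmet hric hxW hs hs1 hLs hL hLs6 hGt hx hft hr0 hν hε₁ hA₁pos
    hνx hμ₀ hUin hA₁ε2 hA₁ε hA₁ν
  obtain ⟨_, hfd, hfd', _⟩ := ikStep_ft_basic hs hLs hx hft hr0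
  obtain ⟨_, _, _, hGthess, hGtap⟩ := ikStep_Gt_basic hGmet hric hs hLs hL hGt
  have haff0 : x + Ls 0 = x := by simp
  have h0W : (0 : E4) ∈ (fun y : E4 => x + Ls y) ⁻¹' W := by
    show x + Ls 0 ∈ W; rwa [haff0]
  -- the non-degeneracy of `D ft(0)`
  have hnorm : A₁⁻¹ ≤ ‖fderiv ℝ ft 0‖ := by
    have hcomp : ‖fderiv ℝ (Kerr.radius a) x‖ ≤
        ‖(fderiv ℝ (Kerr.radius a) x).comp (L : E4 →L[ℝ] E4)‖ * 6 :=
      (ikStep_norm_le_norm_comp_mul _ L).trans (mul_le_mul_of_nonneg_left hLs6 (norm_nonneg _))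
    rw [hfd', norm_smul, Real.norm_eq_abs, abs_of_pos (inv_pos.2 hs)]
    have h1 : A₁⁻¹ ≤ ν / 6 := by
      rw [inv_le_comm₀ hA₁pos (by positivity), inv_div]; exact hA₁ν
    have h2 : ν / 6 ≤ ‖(fderiv ℝ (Kerr.radius a) x).comp (L : E4 →L[ℝ] E4)‖ := by
      rw [div_le_iff₀ (by norm_num)]; exact hνx.trans hcomp
    have h3 : ‖(fderiv ℝ (Kerr.radius a) x).comp (L : E4 →L[ℝ] E4)‖ ≤
        s⁻¹ * ‖(fderiv ℝ (Kerr.radius a) x).comp (L : E4 →L[ℝ] E4)‖ := by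
      have h1s : 1 ≤ s⁻¹ := (one_le_inv₀ hs).2 hs1
      have hn := norm_nonneg ((fderiv ℝ (Kerr.radius a) x).comp (L : E4 →L[ℝ] E4))
      calc ‖(fderiv ℝ (Kerr.radius a) x).comp (L : E4 →L[ℝ] E4)‖
          = 1 * ‖(fderiv ℝ (Kerr.radius a) x).comp (L : E4 →L[ℝ] E4)‖ := (one_mul _).symm
        _ ≤ s⁻¹ * ‖(fderiv ℝ (Kerr.radius a) x).comp (L : E4 →L[ℝ] E4)‖ :=
          mul_le_mul_of_nonneg_right h1s hn
    exact h1.trans (h2.trans h3)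
  refine ⟨hnorm, μ₀, ⟨by linarith [(abs_le.1 hμ₀).1], (abs_le.1 hμ₀).2.trans hA₁ε⟩, fun X ↦ ?_⟩
  -- the Hessian of `ft` for `Gt` at `0`, read through `G` at `x`
  have hhess : hessAt Gt ft 0 X X = hessAt G (Kerr.radius a) x (L X) (L X) := by
    rw [hGthess 0 h0W ft, ← affineCov_eq_pullMetric G Ls x, funext hft]
    have hg2 : ContDiffAt ℝ 2 (fun y : E4 => Kerr.radius a (x + Ls y)) 0 := by
      have haff : ContDiff ℝ 2 (fun y : E4 => x + Ls y) :=
        contDiff_const.add (Ls : E4 →L[ℝ] E4).contDiff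
      have hr2 : ContDiffAt ℝ 2 (Kerr.radius a) (x + Ls 0) := by
        rw [haff0]; exact hr0.of_le (WithTop.coe_le_coe.mpr le_top)
      have g1 := ContDiffAt.comp (g := Kerr.radius a) (f := fun y : E4 => x + Ls y) (0 : E4) hr2
        haff.contDiffAt
      simpa only [Function.comp_def] using g1
    rw [ikStep_hessAt_const_mul_sub _ hg2, smul_apply, smul_apply, smul_eq_mul,
      affineCov_hessAt G (Kerr.radius a) Ls x 0 W hGmet (by rwa [haff0])
        (by rw [haff0]; exact hr0.of_le (WithTop.coe_le_coe.mpr le_top)),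
      haff0, hLs]
    simp only [map_smul, smul_apply, smul_eq_mul]
    field_simp
  have hG0 : Gt 0 X X = G x (L X) (L X) := by
    rw [hGtap, haff0, hLs]
    simp only [map_smul, smul_apply, smul_eq_mul]
    field_simp
  have hD : fderiv ℝ ft 0 X = s⁻¹ * fderiv ℝ (Kerr.radius a) x (L X) := hfd X
  rw [hhess, hG0, hD]
  -- the inequality
  have hw := hUin (L X)
  have hXn : ‖X‖ ≤ 6 * ‖L X‖ :=
    (ikStep_norm_le_mul_norm_apply L X).trans (mul_le_mul_of_nonneg_right hLs6 (norm_nonneg _))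
  have hXn2 : ‖X‖ ^ 2 ≤ 36 * ‖L X‖ ^ 2 := by
    have h := mul_self_le_mul_self (norm_nonneg X) hXn
    nlinarith only [h]
  have hA₁inv : A₁⁻¹ * 36 ≤ ε₁ ^ 2 := by
    rw [inv_mul_le_iff₀ hA₁pos]
    have h1 : 36 * ε₁⁻¹ ^ 2 * ε₁ ^ 2 = 36 := by field_simp
    have h2 : 36 * ε₁⁻¹ ^ 2 * ε₁ ^ 2 ≤ A₁ * ε₁ ^ 2 :=
      mul_le_mul_of_nonneg_right hA₁ε2 (sq_nonneg _)
    linarith only [h1, h2]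
  have hlhs : A₁⁻¹ * ‖X‖ ^ 2 ≤ ε₁ ^ 2 * ‖L X‖ ^ 2 := by
    calc A₁⁻¹ * ‖X‖ ^ 2 ≤ A₁⁻¹ * (36 * ‖L X‖ ^ 2) := by gcongr
      _ = (A₁⁻¹ * 36) * ‖L X‖ ^ 2 := by ring
      _ ≤ ε₁ ^ 2 * ‖L X‖ ^ 2 := by gcongr
  have hcoef : ε₁⁻¹ ^ 2 ≤ A₁ * s⁻¹ ^ 2 := by
    have h0 : 0 ≤ ε₁⁻¹ ^ 2 := sq_nonneg _
    have h1 : ε₁⁻¹ ^ 2 ≤ A₁ := by linarith only [hA₁ε2, h0]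
    have h2 : 1 ≤ s⁻¹ ^ 2 := one_le_pow₀ ((one_le_inv₀ hs).2 hs1)
    calc ε₁⁻¹ ^ 2 ≤ A₁ := h1
      _ = A₁ * 1 := (mul_one _).symm
      _ ≤ A₁ * s⁻¹ ^ 2 := mul_le_mul_of_nonneg_left h2 hA₁pos.le
  have hrhs : ε₁⁻¹ ^ 2 * (fderiv ℝ (Kerr.radius a) x (L X)) ^ 2 ≤
      A₁ * (s⁻¹ * fderiv ℝ (Kerr.radius a) x (L X)) ^ 2 := by
    rw [mul_pow, ← mul_assoc]
    exact mul_le_mul_of_nonneg_right hcoef (sq_nonneg _)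
  linarith [hw, hlhs, hrhs]

end Summit.FinalStateConjecture.FinalStateConjecture.Theorems

end
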